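import Summits.QuantumFields.YangMills.Theorems.BalabanUVNodesN07Thm312PrEntryRowsOfParts
import HarnessLib

/-!
# (3.129) AT ANY SLOT OF THE RECORD: `H₁(U₀; Δ₁) = (G₁Q* in (115)) ∘ ((QG₁Q*)⁻¹ on the blocks)` at def-Y's SLOT-GENERIC `H1OfRecordAt … Δ₁ Q Q′ a hpos hQ`, the (3.133) entry rows of
# `H₁(U₀; Δ₁)` from the two primitive letters, and the (ℓa-H) letter `Prop4LetterH (H₁(U₀; Δ₁)) …` from them — the slot-generic edition of ✓`…N07Thm312PrEntryRowsOfParts` §4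

Cell `pub-ymgap` (HUMAN RULING D-0062, Track A), node N07 [B11] ∕ the K0ᴬ port wall; seat `pub-ymgap-dag-n06-l` (g43; N06 bundle F7 = [B9] Thms 3.12∕3.13).  WHY: ✓`…N07Thm312PrEntryRowsOfParts` (file 1)
stated (3.129)-as-operators and «rows from parts» at the framed slot-(a) pin `H1prOfRecordAtBg` only, while ✓`…N07FrakGPrLetterOfParts` (file 2, row 21) consumes the (ℓa-H) letter of `H₁` at the
framed SLOT (c) (`H1prOfRecordAtBg128`, Hessian `Δ_π + Δ⁽²⁾_π`).  This file restates §4 of file 1 with the Hessian slot `Δ₁` and the averaging pair `(Q, Q′)` as DATA (def-Y's `H1OfRecordAt`), so that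
every pin — bare, slot (a), slot (c), framed or frame-free — is an instance by `rfl`, and adds the (ℓa-H) junction through dag-n07-e's ✓`prop4LetterH_of_entryBounds`.  `--kind definition` (two readings)
`--supports stmt-QuantumFields-27238 --as helper`; count-neutral.  [B9] = [Balaban1985BackgroundPropagators]; [B11] = [Balaban1985Variational]; [4] = [Balaban1984PropagatorsII].

WHAT IS HERE (B-index `PBond (F.P K) k`, block weights `wB` and the site target `F′` of `Q′` generic):
* §1 `g1QadjReadAt … hpos levB` (`G₁(U₀; Δ₁)Q†` read in (115)), `kinvReadAt … hpos levB hQ` (`(QG₁Q†)⁻¹` read on the blocks); ★★ `H1OfRecordAt_eq_comp` — (3.129) as operators at any slot;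
  `g1QadjPrRead_eq` — file 1's framed slot-(a) readings ARE these (`rfl ∧ rfl`).
* §2 ★★★ `h1At_entryRows_of_parts` — entry rows of `G₁Q†` (rate `ρ`, `B₁`) + kernel rows of `(QG₁Q†)⁻¹` (rate `ρ`, `B₂`) ⟹ `entryₙ (H₁(U₀; Δ₁)) y″ y ≤ B₁B₂·d(2(1+2∕ρ))^d·e^{−(ρ∕2)d(y″,y)}`
  (n = 0, 1); ★★★ `prop4LetterH_h1At_of_parts` — node-00 (`∀ x, x ∈ Ω k`): the same two letters ⟹ `Prop4LetterH (H1OfRecordAt … levB Δ₁ Q Q′ a hpos hQ) (B₁B₂·(d(2(1+2∕ρ))^d)²)` — at slot (c)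
  the (ℓa-H)₍c₎ input of file 2's `thm313Printed_recPr_of_parts`, at the framed slot (a) def-Y's `Prop4LetterHPrAtRecord`.
HONEST FRAMING.  Bookkeeping: (3.129) as an operator identity + file 1's (2.61) convolution + n07-e's row sum; the two SOURCE letters (Theorem 3.3-type entry rows of `G₁(U₀; Δ₁)Q†`,
(3.132) kernel rows of `(QG₁Q†)⁻¹`) are DISPLAYED hypotheses, NOT proved anywhere in the tree (XL); nothing of [B9] Thm 3.3 ∕ 3.12 ∕ (3.132) is proved; nothing discharged; K0ᴬ ⟨27238⟩
NOT closed; K0ᴬ∕K1ᴬ∕K3ᴬ 0∕3; NODE O 0∕1; COUNT 8∕28 · K 1∕4 UNMOVED; finite `𝕋⁴_{L^K}` at fixed ε — NOT continuum ∕ ℝ⁴ ∕ OS; **the Yang–Mills mass gap (Clay) is NOT proved by any of this.**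
No `sorry`, `instance`, `notation`, `set_option`; standard axioms.
-/

noncomputable section

open scoped Matrix Matrix.Norms.L2Operator InnerProductSpace ComplexConjugate BigOperators

namespace Summit.QuantumFields.YangMills.BalabanUVNodes.N07H1EntryRowsOfPartsAtSlot

open Literature.MathematicalPhysics.QuantumFieldTheory.Balaban1983to89
open Literature.MathematicalPhysics.QuantumFieldTheory.Balaban1983to89.Node00
open T4Continuum (T4Family)
open B9SectCLatticeCarrier (Bond)
open B9Eq311L2Pairing (WL2)
open B11Eq115Space (NegSup NegSize Space115 JetSup levWeight)
open B11Eq111FrakG (nabla115)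
open B11Eq103H1Complex (SiteL2K BondL2K H1CLM G1LatticeK KinvLatticeK H1LatticeK H1LatticeK_eq H1LatticeCLM)
open Summit.QuantumFields.YangMills.BalabanUVNodes.N07KernelEntriesOfRecord (entry0 entry1 prop4LetterH_of_entryBounds)
open Summit.QuantumFields.YangMills.BalabanUVNodes.N07Thm312PrEntryRowsOfParts (kerBlk blockReadCLM H1CLM_comp entry0_comp_le_of_decay entry1_comp_le_of_decay
  g1QadjPrRead kinvPrRead)

/-! ## §1 The two readings and (3.129) as operators at def-Y's SLOT-GENERIC letter `H1OfRecordAt … Δ₁ Q Q′ a hpos hQ` -/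

section Record

variable (F : T4Family) (N : ℕ) (K k : ℕ) (Ω : ℕ → Set (Site (F.P K) 0)) (U₀ : GaugeField (F.P K) 0 (SU N))
  {wB : PBond (F.P K) k → ℝ} [Fact (∀ y, 0 < wB y)] {F' : Type*} [AddCommGroup F'] [Module ℂ F']
variable [Fact (0 < (F.L : ℝ))] [Fact (0 < (F.P K).eta k)] [Fact (0 < c0Rec F K k)]
variable (Δ₁ : BondL2K ℂ (F.P K).d (fun _ => (F.P K).sitesPerDir 0) (c0Rec F K k) (WRec N) →ₗ[ℂ] BondL2K ℂ (F.P K).d (fun _ => (F.P K).sitesPerDir 0) (c0Rec F K k) (WRec N))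
  (Q : BondL2K ℂ (F.P K).d (fun _ => (F.P K).sitesPerDir 0) (c0Rec F K k) (WRec N) →ₗ[ℂ] WL2 ℂ wB (WRec N))
  (Q' : SiteL2K ℂ (F.P K).d (fun _ => (F.P K).sitesPerDir 0) (c0Rec F K k) (WRec N) →ₗ[ℂ] F') (a : ℝ)
  (hpos : ∀ x, x ≠ 0 → 0 < RCLike.re ⟪x, laplaceAOfRecordAt F N k U₀ Δ₁ Q Q' a x⟫_ℂ) (levB : PBond (F.P K) k → ℕ)

/-- **`G₁(U₀; Δ₁)Q*` READ IN (115)** — lit's `G1LatticeK hpos ∘ Q†` as `|·|₍₋₀₎ →L[ℂ] (115)`, Hessian slot `Δ₁` and pair `(Q, Q′)` DATA (✓`g1QadjPrRead` is the framed slot-(a) instance, `rfl`).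
A reading, nothing asserted. [cite: Balaban1985BackgroundPropagators, (3.129) p.421, (3.128) p.421, Thm 3.3 p.397; Balaban1985Variational, (103) p.293, (110) p.294] -/
def g1QadjReadAt : NegSize (F.L : ℝ) ((F.P K).eta k) levB 0 (Matrix (Fin N) (Fin N) ℂ) →L[ℂ] Space115Lit F N K k Ω U₀ :=
  H1CLM (L := (F.L : ℝ)) (η := (F.P K).eta k) (lev₀ := bondLevLit F Ω k) (levB := levB) (phiRec N) (pairLevLit F Ω k)
    (nabla115 ((F.P K).eta k) (unitsOfRecord F N U₀)) (G1LatticeK hpos ∘ₗ LinearMap.adjoint Q)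

/-- **`(QG₁(U₀; Δ₁)Q*)⁻¹` READ ON THE BLOCKS** — lit's `KinvLatticeK hpos hQ` as `|·|₍₋₀₎ →L[ℂ] |·|₍₋₀₎` (✓`kinvPrRead` is the framed slot-(a) instance, `rfl`). A reading, nothing asserted.
[cite: Balaban1985BackgroundPropagators, (3.129) p.421, (3.132) p.422; Balaban1985Variational, (45) p.285] -/
def kinvReadAt (hQ : Function.Surjective Q) :
    NegSize (F.L : ℝ) ((F.P K).eta k) levB 0 (Matrix (Fin N) (Fin N) ℂ) →L[ℂ] NegSize (F.L : ℝ) ((F.P K).eta k) levB 0 (Matrix (Fin N) (Fin N) ℂ) :=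
  blockReadCLM (L := (F.L : ℝ)) (η := (F.P K).eta k) (levB := levB) (phiRec N) (KinvLatticeK hpos hQ)

/-- ★★ **(3.129) AS OPERATORS AT ANY SLOT**: `H1OfRecordAt … levB Δ₁ Q Q′ a hpos hQ = g1QadjReadAt … ∘ kinvReadAt …` (so `H1OfRecord`, `H1(pr)OfRecordAtBg`, `H1(pr)OfRecordAtBg128` are instances by `rfl`).
[cite: Balaban1985BackgroundPropagators, (3.129) p.421; Balaban1985Variational, (45) p.285, (103) p.293] -/
theorem H1OfRecordAt_eq_comp (hQ : Function.Surjective Q) :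
    H1OfRecordAt F N K k Ω U₀ levB Δ₁ Q Q' a hpos hQ = (g1QadjReadAt F N K k Ω U₀ Δ₁ Q Q' a hpos levB).comp (kinvReadAt F N K k U₀ Δ₁ Q Q' a hpos levB hQ) := by
  unfold H1OfRecordAt H1LatticeCLM g1QadjReadAt kinvReadAt
  rw [H1LatticeK_eq, ← LinearMap.comp_assoc]
  exact H1CLM_comp (phiRec N) (pairLevLit F Ω k) (nabla115 ((F.P K).eta k) (unitsOfRecord F N U₀)) _ _

/-- The framed slot-(a) readings of ✓`…N07Thm312PrEntryRowsOfParts` ARE these at `(hessOpOfRecord, Q^{pr}(U₀), Q′(U₀))` (`rfl`). [cite: Balaban1985BackgroundPropagators, (3.129) p.421 (bookkeeping)] -/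
theorem g1QadjPrRead_eq [NeZero N] [Fact (∀ c, 0 < wBRec F K k c)] (𝔥 : FrameDatum (F.P K) N k U₀)
    (hpos' : ∀ x, x ≠ 0 → 0 < RCLike.re ⟪x, laplaceAOfRecord F N k U₀ (QprOfRecord F N k U₀ 𝔥) (QprimeOfRecord F N k U₀) a x⟫_ℂ)
    (hQ : Function.Surjective (QprOfRecord F N k U₀ 𝔥)) :
    g1QadjPrRead F N K k Ω U₀ 𝔥 levB a hpos' = g1QadjReadAt F N K k Ω U₀ (hessOpOfRecord F N k U₀) (QprOfRecord F N k U₀ 𝔥) (QprimeOfRecord F N k U₀) a hpos' levB ∧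
    kinvPrRead F N K k U₀ 𝔥 levB a hpos' hQ = kinvReadAt F N K k U₀ (hessOpOfRecord F N k U₀) (QprOfRecord F N k U₀ 𝔥) (QprimeOfRecord F N k U₀) a hpos' levB hQ :=
  ⟨rfl, rfl⟩

/-! ## §2 The (3.133) entry rows and the (ℓa-H) letter of `H₁(U₀; Δ₁)` from the two primitive letters, any slot -/

/-- ★★★ **THE (3.133) ENTRY ROWS OF `H₁(U₀; Δ₁)` FROM THE TWO LETTERS, ANY SLOT** (one member ∕ one background; node-00 unit blocks): entry rows of `G₁Q*` (rate `ρ`, `B₁`; Theorem 3.3-type) + kernel rows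
of `(QG₁Q*)⁻¹` (rate `ρ`, `B₂`; (3.132)-type) ⟹ `entryₙ (H₁(U₀; Δ₁)) y″ y ≤ B₁B₂·d(2(1+2∕ρ))^d·e^{−(ρ∕2)d(y″,y)}` (n = 0, 1) — ✓`h1pr_entryRows_of_parts` with the Hessian slot and the pair DATA.
[cite: Balaban1985BackgroundPropagators, Thm 3.12 pp.421–423, (3.129) p.421, (3.132)–(3.133) p.422; Balaban1984PropagatorsII, Lemma 2.1 (2.61) p.234] -/
theorem h1At_entryRows_of_parts (hQ : Function.Surjective Q) {ρ B₁ B₂ : ℝ} (hρ : 0 < ρ) (hB₁ : 0 ≤ B₁) (hB₂ : 0 ≤ B₂)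
    (hG0 : ∀ y'' y₁ : PBond (F.P K) k, entry0 F N K k Ω U₀ levB (g1QadjReadAt F N K k Ω U₀ Δ₁ Q Q' a hpos levB) y'' y₁ ≤ B₁ * Real.exp (-(ρ * (Site.tdist y''.src y₁.src : ℝ))))
    (hG1 : ∀ y'' y₁ : PBond (F.P K) k, entry1 F N K k Ω U₀ levB (g1QadjReadAt F N K k Ω U₀ Δ₁ Q Q' a hpos levB) y'' y₁ ≤ B₁ * Real.exp (-(ρ * (Site.tdist y''.src y₁.src : ℝ))))
    (hKi : ∀ y₁ y : PBond (F.P K) k, ‖kerBlk F N K k levB (kinvReadAt F N K k U₀ Δ₁ Q Q' a hpos levB hQ) y₁ y‖ ≤ B₂ * Real.exp (-(ρ * (Site.tdist y₁.src y.src : ℝ))))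
    (y'' y : PBond (F.P K) k) :
    entry0 F N K k Ω U₀ levB (H1OfRecordAt F N K k Ω U₀ levB Δ₁ Q Q' a hpos hQ) y'' y ≤
        B₁ * B₂ * ((F.P K).d * (2 * (1 + 1 / (ρ / 2))) ^ (F.P K).d) * Real.exp (-(ρ / 2 * (Site.tdist y''.src y.src : ℝ))) ∧
      entry1 F N K k Ω U₀ levB (H1OfRecordAt F N K k Ω U₀ levB Δ₁ Q Q' a hpos hQ) y'' y ≤
        B₁ * B₂ * ((F.P K).d * (2 * (1 + 1 / (ρ / 2))) ^ (F.P K).d) * Real.exp (-(ρ / 2 * (Site.tdist y''.src y.src : ℝ))) := by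
  rw [H1OfRecordAt_eq_comp]
  exact ⟨entry0_comp_le_of_decay F N K k Ω U₀ levB _ _ hρ hB₁ hB₂ hG0 hKi y'' y, entry1_comp_le_of_decay F N K k Ω U₀ levB _ _ hρ hB₁ hB₂ hG1 hKi y'' y⟩

/-- ★★★ **THE (ℓa-H) LETTER OF `H₁(U₀; Δ₁)` FROM THE TWO LETTERS, ANY SLOT (node-00)** — composing the rows above with dag-n07-e's ✓`prop4LetterH_of_entryBounds` (rate `ρ∕2`, one more (2.61) row sum):
`Prop4LetterH (H1OfRecordAt … levB Δ₁ Q Q′ a hpos hQ) (B₁B₂·d(2(1+2∕ρ))^d · d(2(1+2∕ρ))^d)` — at slot (c) this is the (ℓa-H)₍c₎ input of ✓`…N07FrakGPrLetterOfParts.thm313Printed_recPr_of_parts`, at the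
framed slot (a) def-Y's `Prop4LetterHPrAtRecord`. [cite: Balaban1985Variational, (46) p.285, (103) p.293, (117) p.295; Balaban1985BackgroundPropagators, (3.129) p.421, (3.132)–(3.133) p.422; Balaban1984PropagatorsII, (2.61) p.234] -/
theorem prop4LetterH_h1At_of_parts (hΩ : ∀ x, x ∈ Ω k) (hQ : Function.Surjective Q) {ρ B₁ B₂ : ℝ} (hρ : 0 < ρ) (hB₁ : 0 ≤ B₁) (hB₂ : 0 ≤ B₂)
    (hG0 : ∀ y'' y₁ : PBond (F.P K) k, entry0 F N K k Ω U₀ levB (g1QadjReadAt F N K k Ω U₀ Δ₁ Q Q' a hpos levB) y'' y₁ ≤ B₁ * Real.exp (-(ρ * (Site.tdist y''.src y₁.src : ℝ))))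
    (hG1 : ∀ y'' y₁ : PBond (F.P K) k, entry1 F N K k Ω U₀ levB (g1QadjReadAt F N K k Ω U₀ Δ₁ Q Q' a hpos levB) y'' y₁ ≤ B₁ * Real.exp (-(ρ * (Site.tdist y''.src y₁.src : ℝ))))
    (hKi : ∀ y₁ y : PBond (F.P K) k, ‖kerBlk F N K k levB (kinvReadAt F N K k U₀ Δ₁ Q Q' a hpos levB hQ) y₁ y‖ ≤ B₂ * Real.exp (-(ρ * (Site.tdist y₁.src y.src : ℝ)))) :
    Prop4LetterH (H1OfRecordAt F N K k Ω U₀ levB Δ₁ Q Q' a hpos hQ)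
      (B₁ * B₂ * ((F.P K).d * (2 * (1 + 1 / (ρ / 2))) ^ (F.P K).d) * ((F.P K).d * (2 * (1 + 1 / (ρ / 2))) ^ (F.P K).d)) := by
  have hB₀ : 0 ≤ B₁ * B₂ * ((F.P K).d * (2 * (1 + 1 / (ρ / 2))) ^ (F.P K).d) := by positivity
  have h := h1At_entryRows_of_parts F N K k Ω U₀ Δ₁ Q Q' a hpos levB hQ hρ hB₁ hB₂ hG0 hG1 hKi
  exact prop4LetterH_of_entryBounds F N K k Ω U₀ levB _ hΩ hB₀ (half_pos hρ) (fun y'' y => (h y'' y).1) (fun y'' y => (h y'' y).2)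

end Record

end Summit.QuantumFields.YangMills.BalabanUVNodes.N07H1EntryRowsOfPartsAtSlot

end
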